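import Mathlib.Analysis.SpecialFunctions.Log.Deriv
import HarnessLib

/-!
# Buckmaster–Cao-Labora–Gómez-Serrano at `γ = 5/3`: the two self-similar coordinates

Topic `Literature/Analysis/FluidPDE`; namespace
`Literature.Analysis.FluidPDE.BuckmasterCaolaboraGomezserrano2025`. Companion of
`CompressibleEulerImplosion.lean` (named fact `BuckmasterCaolaboraGomezserrano2025_thm11_monatomic`,
THEOREM 1.1 of T. Buckmaster, G. Cao-Labora, J. Gómez-Serrano, *Smooth imploding solutions for 3D
compressible fluids*, Forum Math. Pi 13 (2025) e6, arXiv:2208.09445, at `γ = 5/3`, `α = 1/3`)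
and of `CompressibleEulerImplosionProofs.lean` (the glue layer, whose hypotheses are phrased for the
single profile `𝒲(ζ)` of eq. (1.10)). The paper runs its phase-portrait analysis (Props. 1.6, 2.2–2.3,
3.1, 4.1, §6) in the logarithmic variable `ξ = log ζ` with the unknowns `(W, Z)` of the autonomous
system (1.8), and passes to `ζ` through (1.9) / (2.13):

  `𝒲(ζ) = ζ W(log ζ)`, `𝒵(ζ) = ζ Z(log ζ)` (`ζ > 0`), extended by `𝒲(−ζ) = −𝒵(ζ)`, i.e.
  `W(ξ) = e^{−ξ} 𝒲(e^{ξ})`, `Z(ξ) = −e^{−ξ} 𝒲(−e^{ξ})` (eq. (2.13)).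

This file PROVES the dictionary (theorems only, no facts): if `(W, Z)` satisfy (1.8) at
`ξ = log ζ` (`α = 1/3`: `D_W W′ = N_W`, `D_Z Z′ = N_Z` with `D_W = 1 + (2W+Z)/3`,
`D_Z = 1 + (W+2Z)/3`, `N_W = −(r + 5W/6 + Z/3)W + Z²/6`, `N_Z = −(r + W/3 + 5Z/6)Z + W²/6`), then
the profile `𝒲` satisfies the single equation (1.10) at `ζ` and at `−ζ`
(`profile_eq_of_WZ`, `profile_ode_of_WZ`), in exactly the syntactic form consumed by
`BuckmasterCaolaboraGomezserrano2025.thm11_monatomic_of_profile`; positivity of the rescaled sound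
speed is `W > Z` (`profile_add_profile_neg`); and the end point `P_∞ = (0,0)` as `ξ → +∞`
translates into `𝒲(±ζ)/ζ → 0` as `ζ → +∞` (`tendsto_profile_div`, `tendsto_profile_neg_div`).
[cite: BuckmasterCaolaboraGomezserrano2025, §1.3 eq. (1.8)–(1.10), §2.3 eq. (2.13)]
-/

noncomputable section

open Set Filter Topology

namespace Literature.Analysis.FluidPDE

namespace BuckmasterCaolaboraGomezserrano2025

/-! ### Derivatives of the two branches `ζ W(log ζ)` (`ζ > 0`) and `ζ Z(log(−ζ))` (`ζ < 0`) -/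

/-- `d/dζ [ζ W(log ζ)] = W(log ζ) + W′(log ζ)` for `ζ > 0`. [folklore] -/
theorem hasDerivAt_mul_comp_log {W : ℝ → ℝ} {W' ζ : ℝ} (hζ : 0 < ζ)
    (hW : HasDerivAt W W' (Real.log ζ)) :
    HasDerivAt (fun x => x * W (Real.log x)) (W (Real.log ζ) + W') ζ := by
  have h1 : HasDerivAt (fun x => W (Real.log x)) (W' * ζ⁻¹) ζ :=
    hW.comp ζ (Real.hasDerivAt_log hζ.ne')
  have h2 := (hasDerivAt_id' ζ).mul h1
  refine h2.congr_deriv ?_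
  have hζ' := hζ.ne'
  field_simp

/-- `d/dζ [ζ Z(log(−ζ))] = Z(log η) + Z′(log η)` at `ζ = −η`, `η > 0`. [folklore] -/
theorem hasDerivAt_mul_comp_log_neg {Z : ℝ → ℝ} {Z' η : ℝ} (hη : 0 < η)
    (hZ : HasDerivAt Z Z' (Real.log η)) :
    HasDerivAt (fun x => x * Z (Real.log (-x))) (Z (Real.log η) + Z') (-η) := by
  have hZ' : HasDerivAt Z Z' (Real.log (-η)) := by rwa [Real.log_neg_eq_log]
  have h1 : HasDerivAt (fun x => Z (Real.log x)) (Z' * (-η)⁻¹) (-η) :=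
    hZ'.comp (-η) (Real.hasDerivAt_log (neg_ne_zero.mpr hη.ne'))
  have h2 := (hasDerivAt_id' (-η)).mul h1
  have h3 : HasDerivAt (fun x => x * Z (Real.log x)) (Z (Real.log η) + Z') (-η) := by
    refine h2.congr_deriv ?_
    rw [Real.log_neg_eq_log]
    have hη' := hη.ne'
    field_simp
  have heq : (fun x : ℝ => x * Z (Real.log (-x))) = fun x => x * Z (Real.log x) := by
    funext x; rw [Real.log_neg_eq_log]
  rw [heq]
  exact h3

/-! ### (2.13): `(W, Z)` from the profile and back -/

/-- (2.13): given the profile `𝒲`, the functions `W(ξ) = e^{−ξ}𝒲(e^{ξ})`, `Z(ξ) = −e^{−ξ}𝒲(−e^{ξ})`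
reproduce it: `𝒲(ζ) = ζ W(log ζ)` for `ζ > 0` and `𝒲(ζ) = ζ Z(log(−ζ))` for `ζ < 0`.
[cite: BuckmasterCaolaboraGomezserrano2025, eq. (2.13)] -/
theorem profile_of_WZ_of_profile (𝒲 : ℝ → ℝ) :
    (∀ ζ : ℝ, 0 < ζ → 𝒲 ζ = ζ * (fun ξ => Real.exp (-ξ) * 𝒲 (Real.exp ξ)) (Real.log ζ)) ∧
    (∀ ζ : ℝ, ζ < 0 → 𝒲 ζ = ζ * (fun ξ => -Real.exp (-ξ) * 𝒲 (-Real.exp ξ)) (Real.log (-ζ))) := by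
  constructor
  · intro ζ hζ
    simp only [Real.exp_neg, Real.exp_log hζ]
    field_simp
  · intro ζ hζ
    have hζ' : 0 < -ζ := by linarith
    simp only [Real.exp_neg, Real.exp_log hζ', neg_neg]
    have hζ0 : ζ ≠ 0 := hζ.ne
    field_simp

/-- `𝒲(ζ) + 𝒲(−ζ) = ζ (W − Z)(log ζ)`: positivity of the rescaled sound speed
`S = (𝒲 − 𝒵)/2` for `ζ > 0` is `W > Z` ("the region `W − Z > 0` for which the density is
positive", §1.3). [cite: BuckmasterCaolaboraGomezserrano2025, §1.3] -/
theorem profile_add_profile_neg {W Z 𝒲 : ℝ → ℝ} {ζ : ℝ}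
    (h1 : 𝒲 ζ = ζ * W (Real.log ζ)) (h2 : 𝒲 (-ζ) = -ζ * Z (Real.log (- -ζ))) :
    𝒲 ζ + 𝒲 (-ζ) = ζ * (W (Real.log ζ) - Z (Real.log ζ)) := by
  rw [h1, h2, neg_neg]; ring

/-- `P_∞ = (0,0)`, `W`-component: `W(ξ) → 0` as `ξ → +∞` gives `𝒲(ζ)/ζ → 0` as `ζ → +∞`.
[cite: BuckmasterCaolaboraGomezserrano2025, Prop. 3.1] -/
theorem tendsto_profile_div {W 𝒲 : ℝ → ℝ} (hW : Tendsto W atTop (𝓝 0))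
    (h : ∀ ζ : ℝ, 0 < ζ → 𝒲 ζ = ζ * W (Real.log ζ)) :
    Tendsto (fun ζ => 𝒲 ζ / ζ) atTop (𝓝 0) := by
  have h1 : Tendsto (fun ζ => W (Real.log ζ)) atTop (𝓝 0) := hW.comp Real.tendsto_log_atTop
  refine h1.congr' ?_
  filter_upwards [eventually_gt_atTop 0] with ζ hζ
  rw [h ζ hζ, mul_div_cancel_left₀ _ hζ.ne']

/-- `P_∞ = (0,0)`, `Z`-component: `Z(ξ) → 0` as `ξ → +∞` gives `𝒲(−ζ)/ζ → 0` as `ζ → +∞`.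
[cite: BuckmasterCaolaboraGomezserrano2025, Prop. 3.1] -/
theorem tendsto_profile_neg_div {Z 𝒲 : ℝ → ℝ} (hZ : Tendsto Z atTop (𝓝 0))
    (h : ∀ ζ : ℝ, ζ < 0 → 𝒲 ζ = ζ * Z (Real.log (-ζ))) :
    Tendsto (fun ζ => 𝒲 (-ζ) / ζ) atTop (𝓝 0) := by
  have h1 : Tendsto (fun ζ => -Z (Real.log ζ)) atTop (𝓝 0) := by
    simpa using (hZ.comp Real.tendsto_log_atTop).neg
  refine h1.congr' ?_
  filter_upwards [eventually_gt_atTop 0] with ζ hζ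
  rw [h (-ζ) (by linarith), neg_neg]
  field_simp

/-! ### (1.8) in `ξ = log ζ` gives (1.10) at `ζ` and at `−ζ` -/

/-- **The coordinate dictionary, pointwise.** Let `ζ > 0`, let `W, Z` be differentiable at
`ξ = log ζ` with `D_W W′ = N_W`, `D_Z Z′ = N_Z` there (the autonomous system (1.8) at `α = 1/3`),
and let the profile `𝒲` agree with `x ↦ x W(log x)` near `ζ` and with `x ↦ x Z(log(−x))` near
`−ζ` (eq. (2.13)). Then the single profile equation (1.10) (`α = 1/3`) holds at `ζ` and at `−ζ`,
in the syntactic form of the hypothesis `h_ode` of `thm11_monatomic_of_profile` instantiated at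
`ζ` and at `−ζ`. [cite: BuckmasterCaolaboraGomezserrano2025, §1.3 eq. (1.8)–(1.10), eq. (2.13)] -/
theorem profile_eq_of_WZ {r : ℝ} {W Z 𝒲 : ℝ → ℝ} {W' Z' ζ : ℝ} (hζ : 0 < ζ)
    (hW : HasDerivAt W W' (Real.log ζ)) (hZ : HasDerivAt Z Z' (Real.log ζ))
    (hWeq : (1 + (2 * W (Real.log ζ) + Z (Real.log ζ)) / 3) * W' =
      -(r + 5 * W (Real.log ζ) / 6 + Z (Real.log ζ) / 3) * W (Real.log ζ) + Z (Real.log ζ) ^ 2 / 6)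
    (hZeq : (1 + (W (Real.log ζ) + 2 * Z (Real.log ζ)) / 3) * Z' =
      -(r + W (Real.log ζ) / 3 + 5 * Z (Real.log ζ) / 6) * Z (Real.log ζ) + W (Real.log ζ) ^ 2 / 6)
    (hpos : 𝒲 =ᶠ[𝓝 ζ] fun x => x * W (Real.log x))
    (hneg : 𝒲 =ᶠ[𝓝 (-ζ)] fun x => x * Z (Real.log (-x))) :
    ((r - 1) * 𝒲 ζ + (ζ + 1 / 2 * (𝒲 ζ - 𝒲 (-ζ) + 1 / 3 * (𝒲 ζ + 𝒲 (-ζ)))) * deriv 𝒲 ζ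
        + 1 / 3 / (2 * ζ) * (𝒲 ζ ^ 2 - 𝒲 (-ζ) ^ 2) = 0) ∧
    ((r - 1) * 𝒲 (-ζ) + (-ζ + 1 / 2 * (𝒲 (-ζ) - 𝒲 (- -ζ) + 1 / 3 * (𝒲 (-ζ) + 𝒲 (- -ζ))))
          * deriv 𝒲 (-ζ)
        + 1 / 3 / (2 * -ζ) * (𝒲 (-ζ) ^ 2 - 𝒲 (- -ζ) ^ 2) = 0) := by
  set a := W (Real.log ζ) with ha
  set b := Z (Real.log ζ) with hb
  have hζ' := hζ.ne'
  -- values and derivatives of the profile at `±ζ`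
  have hv1 : 𝒲 ζ = ζ * a := hpos.eq_of_nhds
  have hv2 : 𝒲 (-ζ) = -ζ * b := by
    have := hneg.eq_of_nhds
    simpa only [neg_neg] using this
  have hd1 : deriv 𝒲 ζ = a + W' :=
    ((hasDerivAt_mul_comp_log hζ hW).congr_of_eventuallyEq hpos).deriv
  have hd2 : deriv 𝒲 (-ζ) = b + Z' :=
    ((hasDerivAt_mul_comp_log_neg hζ hZ).congr_of_eventuallyEq hneg).deriv
  simp only [neg_neg]
  rw [hv1, hv2, hd1, hd2]
  have hc1 : 1 / 3 / (2 * ζ) * ((ζ * a) ^ 2 - (-ζ * b) ^ 2) = ζ * (a ^ 2 - b ^ 2) / 6 := by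
    field_simp
    ring
  have hc2 : 1 / 3 / (2 * -ζ) * ((-ζ * b) ^ 2 - (ζ * a) ^ 2) = -ζ * (b ^ 2 - a ^ 2) / 6 := by
    field_simp
    ring
  rw [hc1, hc2]
  constructor
  · linear_combination ζ * hWeq
  · linear_combination (-ζ) * hZeq

/-- **The coordinate dictionary, global form.** If `W, Z : ℝ → ℝ` are differentiable and solve
the autonomous system (1.8) (`α = 1/3`) on all of `ℝ`, and `𝒲(ζ) = ζ W(log ζ)` for `ζ > 0`,
`𝒲(ζ) = ζ Z(log(−ζ))` for `ζ < 0` (eq. (2.13)), then `𝒲` solves the single profile equation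
(1.10) at every `ζ ≠ 0` — hypothesis `h_ode` of `thm11_monatomic_of_profile`.
[cite: BuckmasterCaolaboraGomezserrano2025, §1.3 eq. (1.8)–(1.10), eq. (2.13)] -/
theorem profile_ode_of_WZ {r : ℝ} {W Z 𝒲 : ℝ → ℝ} (hWd : Differentiable ℝ W)
    (hZd : Differentiable ℝ Z)
    (hWeq : ∀ ξ : ℝ, (1 + (2 * W ξ + Z ξ) / 3) * deriv W ξ =
      -(r + 5 * W ξ / 6 + Z ξ / 3) * W ξ + Z ξ ^ 2 / 6)
    (hZeq : ∀ ξ : ℝ, (1 + (W ξ + 2 * Z ξ) / 3) * deriv Z ξ =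
      -(r + W ξ / 3 + 5 * Z ξ / 6) * Z ξ + W ξ ^ 2 / 6)
    (hpos : ∀ ζ : ℝ, 0 < ζ → 𝒲 ζ = ζ * W (Real.log ζ))
    (hneg : ∀ ζ : ℝ, ζ < 0 → 𝒲 ζ = ζ * Z (Real.log (-ζ))) :
    ∀ ζ : ℝ, ζ ≠ 0 →
      (r - 1) * 𝒲 ζ + (ζ + 1 / 2 * (𝒲 ζ - 𝒲 (-ζ) + 1 / 3 * (𝒲 ζ + 𝒲 (-ζ)))) * deriv 𝒲 ζ
        + 1 / 3 / (2 * ζ) * (𝒲 ζ ^ 2 - 𝒲 (-ζ) ^ 2) = 0 := by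
  -- local representations at every `η > 0` and `−η`
  have hloc : ∀ η : ℝ, 0 < η →
      (𝒲 =ᶠ[𝓝 η] fun x => x * W (Real.log x)) ∧
        (𝒲 =ᶠ[𝓝 (-η)] fun x => x * Z (Real.log (-x))) := by
    intro η hη
    constructor
    · filter_upwards [Ioi_mem_nhds hη] with x hx using hpos x hx
    · filter_upwards [Iio_mem_nhds (neg_neg_of_pos hη)] with x hx using hneg x hx
  intro ζ hζ
  rcases lt_or_gt_of_ne hζ with h | h
  · -- `ζ < 0`: apply the second conjunct at `η = −ζ`
    obtain ⟨η, rfl⟩ : ∃ η, ζ = -η := ⟨-ζ, (neg_neg ζ).symm⟩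
    have hη : 0 < η := by linarith
    exact (profile_eq_of_WZ hη (hWd _).hasDerivAt (hZd _).hasDerivAt (hWeq _) (hZeq _)
      (hloc η hη).1 (hloc η hη).2).2
  · exact (profile_eq_of_WZ h (hWd _).hasDerivAt (hZd _).hasDerivAt (hWeq _) (hZeq _)
      (hloc ζ h).1 (hloc ζ h).2).1

end BuckmasterCaolaboraGomezserrano2025

end Literature.Analysis.FluidPDE
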